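import Mathlib
import Summits.Ventures.LatticeQCDFlow.TrivializingMaps.RankOne
import Summits.Ventures.LatticeQCDFlow.TrivializingMaps.TensorShift

/-!
# The vertex: `-∂S·∂f` as a sum of rank-one data on tensored slot systems (THEORY-1 §19.3, file (5c-iii))

HONEST FRAMING. Exact (Metropolis-corrected) sampling algorithms for lattice gauge theory; figures of
merit are autocorrelation/cost numbers at stated couplings and volumes; no continuum-physics claim.
This file is algebra of the tree's link derivatives of the Wilson action; no physics claim.

For the Wilson action `S` (tree: `ambWilsonAction`, `PlaquetteData.linkDeriv_ambWilsonAction`) and a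
datum `f = termF_S(z, x, y)` on a slot system `S = (σ, lnk, pol)`, for every link `e`, basis element `T_a`
and EVERY ambient configuration `W`:

  `-(∂^a_e S)(W) · (∂^a_e f)(W) = ∑_{p : μ<ν} ∑_{b : Bool} ∑_{c : (Fin n)⁴}
      termF_{Q_{p,b} ⊕ S}(z/2, κ_c ⊗ x, (T_a^{Q_{p,b},e} β_c) ⊗ (T_a^{S,e} y))(W)`        (`vertex`)

where `Q_{p,false}` is the tree's plaquette slot system `(plaqIdx p, plaqPol)`, `Q_{p,true}` its
polarity flip (whose coefficient functions are the complex conjugates, `coeffC_not`), and `κ_c`, `β_c`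
are the coordinate vectors at the tree's `ketIdx c`, `braIdx c` (`pv`).  The flip replaces "take the
real part of each factor" by honest complex bookkeeping: `Re A · Re(zB) = Re(z A B)/2 + Re(z Ā B)/2`
(`two_mul_re_mul_re`) and `Ā_{Q} = A_{Q̄}` (`conj_coeffC_braket`).  Also: the base case
`S(W) = const - ∑_{p,c} termF_{Q_p}(1, κ_c, β_c)(W)` (`ambWilsonAction_eq_termF`) and the re-grading of a
datum over the joint Casimir modes on `SU(n)^E` (`termF_coeConfig_eq_sum`).
[ours (bookkeeping); every ingredient folklore / cite: Luscher2010Trivializing §4.3 eq. (4.9)]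
-/

noncomputable section

namespace Summit.Ventures.LatticeQCDFlow.TrivializingMaps.Vertex

open scoped ComplexConjugate Matrix Matrix.Norms.Frobenius InnerProductSpace ContDiff
open Finset
open Literature.MathematicalPhysics.QuantumFieldTheory
open Literature.MathematicalPhysics.QuantumFieldTheory.Luscher2010
open SlotRepresentation SlotCasimir SlotCoefficient SlotHilbert JointGrading CasimirGrading PlaquetteData
  SlotTensor TensorShift RankOne

variable {n : ℕ} {σ : Type*} [Fintype σ]

/-! ## 1. Polarity flip = complex conjugation -/

/-- `polM (!b) M = conj ∘ polM b M`. [folklore] -/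
theorem polM_not (b : Bool) (M : Matrix (Fin n) (Fin n) ℂ) :
    polM (!b) M = (polM b M).map (starRingEnd ℂ) := by
  cases b
  · ext i j; simp
  · simp

/-- Kronecker products commute with entrywise conjugation. [folklore] -/
theorem kronPi_map_conj (A : σ → Matrix (Fin n) (Fin n) ℂ) :
    kronPi (fun s => (A s).map (starRingEnd ℂ)) = (kronPi A).map (starRingEnd ℂ) := by
  ext I J; simp [kronPi_apply, map_prod]

/-- **Flipping all polarities conjugates the slot representation.** [folklore] -/
theorem slotRep_not {E : Type*} (lnk : σ → E) (pol : σ → Bool) (W : E → Matrix (Fin n) (Fin n) ℂ) :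
    slotRep lnk (fun s => !pol s) W = (slotRep lnk pol W).map (starRingEnd ℂ) := by
  unfold slotRep; rw [← kronPi_map_conj]; simp only [polM_not]

variable [DecidableEq σ]

/-- `ins` commutes with entrywise conjugation. [folklore] -/
theorem ins_map_conj (s : σ) (Z : Matrix (Fin n) (Fin n) ℂ) :
    ins s (Z.map (starRingEnd ℂ)) = (ins s Z).map (starRingEnd ℂ) := by
  unfold ins; rw [← kronPi_map_conj]; congr 1; funext t
  by_cases h : t = s
  · subst h; simp
  · simp [Function.update_of_ne h, Matrix.map_one]

/-- **Flipping all polarities conjugates the generators.** [folklore] -/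
theorem slotGen_not {E : Type*} [DecidableEq E] (lnk : σ → E) (pol : σ → Bool) (e : E)
    (Y : Matrix (Fin n) (Fin n) ℂ) :
    slotGen lnk (fun s => !pol s) e Y = (slotGen lnk pol e Y).map (starRingEnd ℂ) := by
  ext I J
  simp only [slotGen, Matrix.sum_apply, Matrix.map_apply, map_sum]
  refine Finset.sum_congr rfl fun s _ => ?_
  split_ifs with h
  · rw [polM_not, ins_map_conj, Matrix.map_apply]
  · simp

variable {d L : ℕ}

/-- **Flipping all polarities conjugates coefficient functions**: `coeffC_{Q̄}(ā) = conj coeffC_Q(a)`.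
[folklore] -/
theorem coeffC_not (lnk : σ → Edge d L) (pol : σ → Bool) (a : Kernel σ n) (W : AmbConfig d L n) :
    coeffC lnk (fun s => !pol s) (fun I J => conj (a I J)) W = conj (coeffC lnk pol a W) := by
  simp only [coeffC, map_sum, map_mul, slotRep_not, Matrix.map_apply]

/-! ## 2. Coordinate vectors and bra-ket coefficient functions -/

/-- The coordinate vector `e_{J₀}` of the slot space. [folklore] -/
def pv (J₀ : σ → Fin n) : SlotSpace σ n := WithLp.toLp 2 fun J => if J = J₀ then (1 : ℂ) else 0

/-- Entries of `pv`. [folklore] -/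
@[simp] theorem ofLp_pv_apply (J₀ J : σ → Fin n) :
    WithLp.ofLp (pv J₀) J = if J = J₀ then (1 : ℂ) else 0 := rfl

/-- `‖e_{J₀}‖ = 1`. [folklore] -/
theorem norm_pv (J₀ : σ → Fin n) : ‖(pv J₀ : SlotSpace σ n)‖ = 1 := by
  have h : ‖(pv J₀ : SlotSpace σ n)‖ ^ 2 = 1 := by
    rw [norm_sq_eq_sum, Finset.sum_eq_single J₀]
    · simp
    · intro J _ hJ; simp [hJ]
    · intro h; exact absurd (Finset.mem_univ J₀) h
  have h0 : 0 ≤ ‖(pv J₀ : SlotSpace σ n)‖ := norm_nonneg _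
  nlinarith [h, h0]

/-- `|e_{J₀}⟩⟨e_{I₀}|` is the elementary kernel. [folklore] -/
theorem rank1_pv (I₀ J₀ : σ → Fin n) : rank1 (pv J₀) (pv I₀) = elemKer I₀ J₀ := by
  funext I J
  simp only [rank1_apply, ofLp_pv_apply, elemKer, apply_ite (starRingEnd ℂ), map_one, map_zero]
  by_cases hI : I = I₀ <;> by_cases hJ : J = J₀ <;> simp [hI, hJ]

/-- `conj ∘ (G v)` for a coordinate vector: `conj((G e_{I₀})_I) = (Ḡ e_{I₀})_I`. [folklore] -/
theorem conj_ofLp_toE_pv (G : Matrix (σ → Fin n) (σ → Fin n) ℂ) (I₀ I : σ → Fin n) :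
    conj (WithLp.ofLp (toE G (pv I₀)) I) = WithLp.ofLp (toE (G.map (starRingEnd ℂ)) (pv I₀)) I := by
  simp only [Matrix.ofLp_toEuclideanCLM, Matrix.mulVec, dotProduct, ofLp_pv_apply, Matrix.map_apply,
    map_sum, map_mul, apply_ite (starRingEnd ℂ), map_one, map_zero]

/-- Conjugating the bra-ket kernel `|e_{J₀}⟩⟨G e_{I₀}|` conjugates `G`. [folklore] -/
theorem conj_rank1_pv (G : Matrix (σ → Fin n) (σ → Fin n) ℂ) (I₀ J₀ I J : σ → Fin n) :
    conj (rank1 (pv J₀) (toE G (pv I₀)) I J) = rank1 (pv J₀) (toE (G.map (starRingEnd ℂ)) (pv I₀)) I J := by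
  simp only [rank1_apply, ofLp_pv_apply, Matrix.ofLp_toEuclideanCLM, Matrix.mulVec, dotProduct,
    Matrix.map_apply, map_sum, map_mul, apply_ite (starRingEnd ℂ), map_one, map_zero,
    starRingEnd_self_apply]

/-- **Contraction of the elementary kernel with a skew generator is a bra-ket kernel**:
`coeffC(elemKer I₀ J₀ ⋆ T^{σ,e}_Y) = - coeffC(|e_{J₀}⟩⟨T^{σ,e}_Y e_{I₀}|)` (`Y` skew). [ours] -/
theorem coeffC_contract_elemKer (lnk : σ → Edge d L) (pol : σ → Bool) (I₀ J₀ : σ → Fin n) (e : Edge d L)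
    {Y : Matrix (Fin n) (Fin n) ℂ} (hY : Yᴴ = -Y) (W : AmbConfig d L n) :
    coeffC lnk pol (contract (elemKer I₀ J₀) (slotGen lnk pol e Y)) W
      = -coeffC lnk pol (rank1 (pv J₀) (genCLM lnk pol e Y (pv I₀))) W := by
  rw [← rank1_pv, contract_rank1, slotGen_conjTranspose_of_skew lnk pol e hY, toE_neg]
  show coeffC lnk pol (rank1 (pv J₀) (-(toE (slotGen lnk pol e Y) (pv I₀)))) W = _
  rw [rank1_neg_right, coeffC_neg]

/-- **The flip**: `conj coeffC_Q(|κ⟩⟨T^{Q,e}_Y β|) = coeffC_{Q̄}(|κ⟩⟨T^{Q̄,e}_Y β|)` for coordinate vectors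
`κ, β`. [ours] -/
theorem conj_coeffC_braket (lnk : σ → Edge d L) (pol : σ → Bool) (I₀ J₀ : σ → Fin n) (e : Edge d L)
    (Y : Matrix (Fin n) (Fin n) ℂ) (W : AmbConfig d L n) :
    conj (coeffC lnk pol (rank1 (pv J₀) (genCLM lnk pol e Y (pv I₀))) W)
      = coeffC lnk (fun s => !pol s) (rank1 (pv J₀) (genCLM lnk (fun s => !pol s) e Y (pv I₀))) W := by
  rw [← coeffC_not]
  congr 1
  funext I J
  rw [genCLM, genCLM, slotGen_not, conj_rank1_pv]

/-! ## 3. The plaquette systems `Q_{p,b}` -/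

/-- Polarities of the plaquette system and of its flip: `polB false = plaqPol`, `polB true = ¬plaqPol`.
[ours] -/
def polB : Bool → Fin 4 → Bool
  | false => plaqPol
  | true => fun s => !plaqPol s

/-- `polB false` is the tree's plaquette polarity. [ours] -/
@[simp] theorem polB_false : polB false = plaqPol := rfl

/-- `polB true` is the flipped plaquette polarity. [ours] -/
@[simp] theorem polB_true : polB true = fun s => !plaqPol s := rfl

/-- Contraction is additive in the kernel. [folklore] -/
theorem contract_finset_sum_left {κ : Type*} (s : Finset κ) (a : κ → Kernel σ n)
    (G : Matrix (σ → Fin n) (σ → Fin n) ℂ) : contract (∑ i ∈ s, a i) G = ∑ i ∈ s, contract (a i) G := by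
  funext K J
  simp only [contract, Finset.sum_apply, Finset.sum_mul]
  rw [Finset.sum_comm]

/-- `2 Re(a) Re(v) = Re(v a) + Re(v ā)`. [folklore] -/
theorem two_mul_re_mul_re (a v : ℂ) : 2 * (a.re * v.re) = (v * a).re + (v * conj a).re := by
  simp only [Complex.mul_re, Complex.conj_re, Complex.conj_im]; ring

/-- Real scalars on the coefficient come out of `termF`. [ours] -/
theorem termF_real_mul_left (lnk : σ → Edge d L) (pol : σ → Bool) (r : ℝ) (z : ℂ) (x y : SlotSpace σ n)
    (W : AmbConfig d L n) : termF lnk pol ((r : ℂ) * z) x y W = r * termF lnk pol z x y W := by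
  rw [termF_apply, termF_apply, mul_assoc, Complex.re_ofReal_mul]

/-- **The base case**: `S(W) = ∑_{p : μ<ν} (n - ∑_c termF_{Q_p}(1, κ_c, β_c)(W))` for every ambient `W`.
[ours] -/
theorem ambWilsonAction_eq_termF [NeZero L] (W : AmbConfig d L n) :
    ambWilsonAction W = ∑ p : Site d L × Fin d × Fin d, if p.2.1 < p.2.2 then
      (n : ℝ) - ∑ c : Fin n × Fin n × Fin n × Fin n,
        termF (plaqIdx p.1 p.2.1 p.2.2) plaqPol 1 (pv (ketIdx c)) (pv (braIdx c)) W else 0 := by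
  rw [ambWilsonAction_eq]
  refine Finset.sum_congr rfl fun p _ => ?_
  split_ifs with hp
  · congr 1
    show (coeffC _ _ (plaqKer n) W).re = _
    rw [plaqKer, coeffC_sum, Complex.re_sum]
    refine Finset.sum_congr rfl fun c _ => ?_
    rw [termF_apply, one_mul, ← coeffC_rank1, rank1_pv]
  · rfl

/-- **The vertex.**  For a datum `f = termF_S(z,x,y)`, every link `e`, basis element `a` and EVERY
ambient configuration `W`:
`-(∂^a_e S)(W)(∂^a_e f)(W) = ∑_{p:μ<ν} ∑_b ∑_c termF_{Q_{p,b}⊕S}(z/2, κ_c ⊗ x, T_a^{Q,e}β_c ⊗ T_a^{S,e}y)(W)`.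
[ours] -/
theorem vertex [NeZero L] (B : SuBasis n) (lnk : σ → Edge d L) (pol : σ → Bool) (z : ℂ) (x y : SlotSpace σ n)
    (e : Edge d L) (a : B.ι) (W : AmbConfig d L n) :
    -(linkDeriv e (B.T a) (ambWilsonAction : AmbConfig d L n → ℝ) W
        * linkDeriv e (B.T a) (termF lnk pol z x y) W)
      = ∑ p : Site d L × Fin d × Fin d, if p.2.1 < p.2.2 then
          ∑ b : Bool, ∑ c : Fin n × Fin n × Fin n × Fin n,
            termF (Sum.elim (plaqIdx p.1 p.2.1 p.2.2) lnk) (Sum.elim (polB b) pol) (((1 / 2 : ℝ) : ℂ) * z)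
              (tens (pv (ketIdx c)) x)
              (tens (genCLM (plaqIdx p.1 p.2.1 p.2.2) (polB b) e (B.T a) (pv (braIdx c)))
                (genCLM lnk pol e (B.T a) y)) W
        else 0 := by
  rw [linkDeriv_ambWilsonAction, linkDeriv_termF_skew lnk pol z x y e (skew_T B a), neg_mul_neg,
    Finset.sum_mul, ← Finset.sum_neg_distrib]
  refine Finset.sum_congr rfl fun p _ => ?_
  split_ifs with hp
  · -- one plaquette `Q = Q_p`, generator `G = T_a^{Q,e}`, old generator image `w = T_a^{S,e} y`
    set lq := plaqIdx p.1 p.2.1 p.2.2 with hlq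
    set w := genCLM lnk pol e (B.T a) y with hw
    show -((coeffC lq plaqPol (contract (plaqKer n) (slotGen lq plaqPol e (B.T a))) W).re
        * termF lnk pol z x w W) = _
    rw [plaqKer, contract_finset_sum_left, coeffC_sum, Complex.re_sum, Finset.sum_mul,
      ← Finset.sum_neg_distrib, Finset.sum_comm]
    refine Finset.sum_congr rfl fun c _ => ?_
    rw [coeffC_contract_elemKer lq plaqPol _ _ e (skew_T B a), Complex.neg_re, neg_mul, neg_neg,
      Fintype.sum_bool, polB_true, polB_false, termF_real_mul_left, termF_real_mul_left, ← mul_add]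
    -- `Re A · Re(zB) = ½ (Re(zB·A) + Re(zB·Ā))`
    have hB : termF lnk pol z x w W = (z * coeffC lnk pol (rank1 x w) W).re := by
      rw [termF_apply, coeffC_rank1]
    have hprod : ∀ (pol' : Fin 4 → Bool) (u : SlotSpace (Fin 4) n),
        z * coeffC lnk pol (rank1 x w) W * coeffC lq pol' (rank1 (pv (ketIdx c)) u) W
          = z * coeffC (Sum.elim lq lnk) (Sum.elim pol' pol) (rank1 (tens (pv (ketIdx c)) x) (tens u w)) W := by
      intro pol' u
      rw [coeffC_rank1, coeffC_rank1, coeffC_rank1, mul_assoc, mul_comm ⟪w, _⟫_ℂ, inner_repCLM_mul]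
    have h2 := two_mul_re_mul_re
      (coeffC lq plaqPol (rank1 (pv (ketIdx c)) (genCLM lq plaqPol e (B.T a) (pv (braIdx c)))) W)
      (z * coeffC lnk pol (rank1 x w) W)
    rw [conj_coeffC_braket, hprod, hprod] at h2
    rw [hB, termF_apply, termF_apply, ← coeffC_rank1, ← coeffC_rank1]
    linarith [h2]
  · simp

/-! ## 4. Re-grading a datum over the joint Casimir modes (on the field manifold) -/

/-- **Re-grading**: on `SU(n)^E`, `termF(z,x,y) = ∑_m termF(z, P_m x, P_m y)` over the joint modes `m` of
the slot Casimirs (needs unitary links: `R_σ(U)` commutes with the projections). [ours] -/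
theorem termF_coeConfig_eq_sum [NeZero L] (lnk : σ → Edge d L) (pol : σ → Bool) (B : SuBasis n) (z : ℂ)
    (x y : SlotSpace σ n) (U : GaugeConfig d L (Matrix.specialUnitaryGroup (Fin n) ℂ)) :
    termF lnk pol z x y (WilsonFlow.coeConfig U)
      = ∑ m : Modes (casimirFamily lnk pol B),
          termF lnk pol z (jointProj (casimirFamily lnk pol B) m x) (jointProj (casimirFamily lnk pol B) m y)
            (WilsonFlow.coeConfig U) := by
  rw [termF_apply, ← inner_conj_symm, inner_repCLM_eq_sum lnk pol B (coeConfig_mem_unitaryGroup U) x y,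
    map_sum, Finset.mul_sum, Complex.re_sum]
  refine Finset.sum_congr rfl fun m _ => ?_
  rw [termF_apply, inner_conj_symm]

/-- The mass of the re-graded pieces is controlled by the grading:
`∑_m ‖P_m x‖ ‖P_m y‖ ≤ ‖x‖ ‖y‖`. [ours] -/
theorem sum_norm_jointProj_mul_le [NeZero L] (lnk : σ → Edge d L) (pol : σ → Bool) (B : SuBasis n)
    (x y : SlotSpace σ n) :
    ∑ m : Modes (casimirFamily lnk pol B),
        ‖jointProj (casimirFamily lnk pol B) m x‖ * ‖jointProj (casimirFamily lnk pol B) m y‖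
      ≤ ‖x‖ * ‖y‖ :=
  (isGrading_slotJointProj lnk pol B).sum_norm_mul_norm_le x y

end Summit.Ventures.LatticeQCDFlow.TrivializingMaps.Vertex
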